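import Summits.AtomisticToContinuum.HydrodynamicLimit.Theorems.InformationPercolationEngineCollisionRate
import Summits.AtomisticToContinuum.HydrodynamicLimit.Theorems.InformationPercolationEngineCollisionRateTubeRegular
import Summits.AtomisticToContinuum.HydrodynamicLimit.Theorems.JParityClosureOddContactSymmetryGibbsInvariance
import Literature.MathematicalPhysics.KineticTheory.CollisionWindowCompensator
import Literature.MathematicalPhysics.KineticTheory.StaticHazardLLN
import Literature.MathematicalPhysics.KineticTheory.EnskogRateConstMarkLLN
import Literature.MathematicalPhysics.KineticTheory.CellOccupancyLargeDeviation
import Literature.MathematicalPhysics.KineticTheory.HardSphereUniformGasShift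
import HarnessLib

/-!
# S3|const · mesoscale regularity at constant profiles (`stub_mesoscaleRegularityConst`, line `Sketch` of crux
# `InformationPercolationEngine.CollisionRate`, stmt-AtomisticToContinuum-13481)

The rung-0 instance of the line's stub S3: under the canonical law `G' = localGibbsLaw σ ā ū θ̄ N Φ` of `N + 1` hard
spheres of reduced diameter `σ` (constant profiles; invariant under every flow map, `map_flow_localGibbsLaw_const`), the
statistic `WS(h*, D) − WS(h*·dil, D) + (σ³w/ε) WS(h*·dil, ν̂) − RE` of the composition `CollisionRate_of` is small in
probability at the admissible cell sizes `r' = 1/(2m)`, `m ≥ m₀`, for `N ≥ N₀`.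

Proof.  (i) The CLUMP TERM `WS(h*, D) − WS(h*·dil, D)` vanishes identically off the event that at some window start some
toroidal dilute cut is `0`; that event forces a cell of reduced density `> η̄`, i.e. an occupancy `> (η̄/σ³)(N+1)r'³` with
`η̄/σ³ ≥ 20` (we take `σ₀³ ≤ η₀'/20`): by stationarity and the Ruelle-type large-deviation bound
`exists_forall_succ_mul_posGibbs_real_le` its probability, summed over the `Kw ≤ (τ/a + 1)(N+1)` windows, is `≤ δ/4`
for `N` large.  (ii) The remaining MAIN TERM is `Σ_{k<Kw} σ³ w (cellRate(kw, p_k z) − e_{kw}(Φ_{kw} z))`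
(`mainSum_eq`: the window sum of `h*·dil·ν̂` is `ε Σ_k cellRate`, the Riemann–Enskog sum is `σ³ Σ_k w e_k`); window by
window both functionals are read on `Φ_{kw} z ~ G'` (stationarity, `lintegral_comp_flow_localGibbsLaw_const`) and
concentrate in `L¹(G')` at the SAME constant `(∫χ(kw,·)) g(σ³)Y(σ³) π E‖v − w‖`: the cell side by
`exists_forall_lintegral_cellRate_sub_le` (cell-occupancy LLN, in-cell relative-speed `U`-statistic, Riemann sums of the
cone mollifier and of `χ`), the Enskog side by `exists_forall_lintegral_enskogRate_one_sub_le`; Markov on the sum over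
the windows (`Kw · w = τ`) gives `≤ δ/4`.  The contact value `Y` is bounded on `[0, η₁/2]` and continuous on `(0, η₁)` by
the proved equation of state (`hsEosLowDensity_JParityClosure`); `η₃ := η₁/2`.  `CollisionMomentBound` is not used.
-/

noncomputable section

open MeasureTheory Set Filter Topology
open scoped ENNReal BigOperators

namespace Summit.AtomisticToContinuum.HydrodynamicLimit.Theorems.CollisionRate

open Summit.AtomisticToContinuum.HydrodynamicLimit.Theses.InformationPercolationEngine
open Literature.Analysis.FluidPDE Literature.MathematicalPhysics.KineticTheory
open Summit.AtomisticToContinuum.HydrodynamicLimit.Theorems.EvenStressEnskog (deriv_hsExcessFreeEnergy_zero)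

/-! ## Regularity of the contact value and of the cutoff -/

/-- **The contact value is bounded near `0` and continuous on the low-density band**: there is `η₁ > 0` (the
analyticity radius of the excess free energy, `hsEosLowDensity_JParityClosure`) with `|Y| ≤ K_Y` on `[0, η₁/2]` and `Y`
continuous at every `s ∈ (0, η₁)` (`Y = (3/2π) F'` there, `Y(0) = 0` is `deriv`-junk). [folklore] -/
theorem contactValue_regular : ∃ η₁ : ℝ, 0 < η₁ ∧ (∃ KY : ℝ, ∀ y, 0 ≤ y → y ≤ η₁ / 2 → |contactValue y| ≤ KY) ∧
    ∀ s, 0 < s → s < η₁ → ContinuousAt contactValue s := by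
  obtain ⟨η₁, hη₁, F, hF, hEq, -, -, -⟩ := hsEosLowDensity_JParityClosure
  have hY : ∀ s, 0 < s → s < η₁ → (fun b => 3 / (2 * Real.pi) * deriv F b) =ᶠ[𝓝 s] contactValue := by
    intro s hs hs'
    have hnhds : hsExcessFreeEnergy =ᶠ[𝓝 s] F :=
      Filter.eventuallyEq_of_mem (isOpen_Ioo.mem_nhds ⟨hs, hs'⟩) (hEq.mono Ioo_subset_Ico_self)
    exact hnhds.deriv.mono fun b hb => by rw [contactValue, hb]
  refine ⟨η₁, hη₁, ?_, fun s hs hs' => ?_⟩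
  · have hcont : ContinuousOn (deriv F) (Icc 0 (η₁ / 2)) :=
      hF.deriv.continuousOn.mono (Icc_subset_Ioo (by linarith) (by linarith))
    obtain ⟨CF, hCF⟩ := (isCompact_Icc (a := (0 : ℝ)) (b := η₁ / 2)).exists_bound_of_continuousOn hcont
    refine ⟨max (3 / (2 * Real.pi) * CF) 0, fun y hy0 hy1 => ?_⟩
    rcases hy0.eq_or_lt with h0 | hpos
    · rw [← h0, contactValue, deriv_hsExcessFreeEnergy_zero, mul_zero, abs_zero]; exact le_max_right _ _
    · have h := (hY y hpos (by linarith)).eq_of_nhds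
      rw [← h, abs_mul, abs_of_pos (by positivity : (0 : ℝ) < 3 / (2 * Real.pi))]
      refine le_trans (mul_le_mul_of_nonneg_left ?_ (by positivity)) (le_max_left _ _)
      simpa only [Real.norm_eq_abs] using hCF y ⟨hy0, hy1⟩
  · have hFc : ContinuousAt (deriv F) s := hF.deriv.continuousOn.continuousAt (isOpen_Ioo.mem_nhds ⟨by linarith, hs'⟩)
    exact (hFc.const_mul _).congr (hY s hs hs')

/-! ## The window terms under the invariant law -/

section Window

variable {σ ab θb : ℝ} {ub : V3} {N : ℕ} (Φ : HardSphereFlow (Torus.geometry (Fin 3)) (hsDiameter σ N) (N + 1))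
  {χ : ℝ × T3 → ℝ} {g : ℝ → ℝ} (r r' ηb : ℝ)

/-- The one-time functional of window `k`: `F_t(ζ) = cellRate(t, coarse state of ζ) − e_t(ζ)` is measurable. [folklore] -/
theorem measurable_windowFunctional (σ : ℝ) (N : ℕ) (hχ : Continuous χ) (hg : Continuous g) (r r' ηb t : ℝ) :
    Measurable fun ζ : Config (N + 1) (Fin 3) T3 =>
      cellRate σ N χ g r r' ηb t (coarseConfig (Torus.coarseCell r') ζ) - enskogRate σ N χ g (fun _ => 1) r t ζ :=
  ((measurable_cellRate σ N χ g r r' ηb t).comp (measurable_coarseConfig (Torus.measurable_coarseCell r'))).sub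
    ((measurable_enskogRate_prod σ N hχ hg measurable_sphereMark_one r).comp (measurable_const.prodMk measurable_id))

/-- **Stationarity of the window terms**: the `G'`-`lintegral` of the window-`k` term is `σ³ w` times the STATIC
`lintegral` of the one-time functional at time label `kw` (`p_k = coarse state ∘ Φ_{kw}`, `G'` is `Φ_{kw}`-invariant).
[folklore] -/
theorem lintegral_windowTerm_eq (hσ : 0 ≤ σ) (hχ : Continuous χ) (hg : Continuous g) (τ a : ℝ) (hw : 0 ≤ windowLen N τ a)
    (k : ℕ) :
    ∫⁻ z, ‖σ ^ 3 * windowLen N τ a *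
        (cellRate σ N χ g r r' ηb ((k : ℝ) * windowLen N τ a) (coarseStateAt σ N Φ r' τ a k z) -
          enskogRate σ N χ g (fun _ => 1) r ((k : ℝ) * windowLen N τ a) (Φ.flow ((k : ℝ) * windowLen N τ a) z))‖ₑ
        ∂(localGibbsLaw σ (fun _ => ab) (fun _ => ub) (fun _ => θb) N Φ) =
      ENNReal.ofReal (σ ^ 3 * windowLen N τ a) *
        ∫⁻ ζ, ‖cellRate σ N χ g r r' ηb ((k : ℝ) * windowLen N τ a) (coarseConfig (Torus.coarseCell r') ζ) -
            enskogRate σ N χ g (fun _ => 1) r ((k : ℝ) * windowLen N τ a) ζ‖ₑ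
          ∂(localGibbsLaw σ (fun _ => ab) (fun _ => ub) (fun _ => θb) N Φ) := by
  have hm := (measurable_windowFunctional σ N hχ hg r r' ηb ((k : ℝ) * windowLen N τ a)).enorm
  have hflow := lintegral_comp_flow_localGibbsLaw_const σ ab θb ub N Φ ((k : ℝ) * windowLen N τ a) hm
  have e : ∀ x : ℝ, ‖σ ^ 3 * windowLen N τ a * x‖ₑ = ENNReal.ofReal (σ ^ 3 * windowLen N τ a) * ‖x‖ₑ := fun x => by
    rw [enorm_mul, Real.enorm_eq_ofReal (mul_nonneg (pow_nonneg hσ 3) hw)]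
  simp_rw [e]
  rw [lintegral_const_mul' _ _ ENNReal.ofReal_ne_top]
  congr 1

end Window

/-! ## The registered stub -/

set_option maxHeartbeats 1600000 in
/-- **S3|const · mesoscale regularity at constant profiles** (registered stub `stub_mesoscaleRegularityConst` of the line
`Sketch` of crux `InformationPercolationEngine.CollisionRate`, verbatim; the rung-0 instance of S3).  `η₃ := η₁/2`
(`η₁` the analyticity radius of the hard-sphere equation of state); `σ₀ := min σ_sd (min 1 (η₀'/20))`; `r₀ := 1/4`; `m₀`
from the cell-side law of large numbers; `N₀` from the cell side, the Enskog side and the dense-cell large deviation.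
`CollisionMomentBound` is not used. [folklore] -/
theorem stub_mesoscaleRegularityConst :
    CollisionMomentBound →
    ∃ η₃ : ℝ, 0 < η₃ ∧ ∀ η₀' ηb : ℝ, 0 < η₀' → η₀' < ηb → ηb ≤ η₃ →
      ∀ (ab θb : ℝ) (ub : V3), 0 < ab → 0 < θb → ∃ σ₀ : ℝ, 0 < σ₀ ∧ ∀ σ : ℝ, 0 < σ → σ < σ₀ →
      ∀ Φ : (N : ℕ) → HardSphereFlow (Torus.geometry (Fin 3)) (hsDiameter σ N) (N + 1),
      ∀ τ : ℝ, 0 < τ → ∀ χ : ℝ × T3 → ℝ, Continuous χ → ∀ g : ℝ → ℝ, Continuous g →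
      (∀ x, η₀' ≤ x → g x = 0) →
      ∀ η δ : ℝ, 0 < η → 0 < δ → ∃ r₀ : ℝ, 0 < r₀ ∧ ∀ r : ℝ, 0 < r → r < r₀ →
      ∃ m₀ : ℕ, ∀ m : ℕ, m₀ ≤ m → 1 ≤ m → ∀ a : ℝ, 0 < a → ∃ N₀ : ℕ, ∀ N : ℕ, N₀ ≤ N →
        localGibbsLaw σ (fun _ => ab) (fun _ => ub) (fun _ => θb) N (Φ N)
          {z | η < |windowSum σ N (Φ N) (admissibleCellSize m) τ a
                (hazardWeight σ N χ g r (admissibleCellSize m) τ a) (windowCollisions σ N (Φ N) τ a) z -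
              windowSum σ N (Φ N) (admissibleCellSize m) τ a
                (fun i k p => hazardWeight σ N χ g r (admissibleCellSize m) τ a i k p *
                  toroidalDiluteCut σ N (admissibleCellSize m) ηb i p)
                (windowCollisions σ N (Φ N) τ a) z +
              σ ^ 3 * windowLen N τ a / hsDiameter σ N *
                windowSum σ N (Φ N) (admissibleCellSize m) τ a
                  (fun i k p => hazardWeight σ N χ g r (admissibleCellSize m) τ a i k p *
                    toroidalDiluteCut σ N (admissibleCellSize m) ηb i p)
                  (fun i k z => staticHazard σ N (admissibleCellSize m)
                    (coarseStateAt σ N (Φ N) (admissibleCellSize m) τ a k z) i) z -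
              riemannEnskog σ N (Φ N) τ a χ g r z|}
          ≤ ENNReal.ofReal δ := by
  intro _hCMB
  obtain ⟨η₁, hη₁, ⟨KY, hKY⟩, hYc⟩ := contactValue_regular
  refine ⟨η₁ / 2, by positivity, ?_⟩
  intro η₀' ηb hη₀' hηlt hηb3 ab θb ub hab hθb
  obtain ⟨σsd, hσsd, hsmall⟩ := exists_smallDensity uniformProfile one_pos
  refine ⟨min σsd (min 1 (η₀' / 20)), lt_min hσsd (lt_min one_pos (by positivity)), ?_⟩
  intro σ hσ hσlt Φ τ hτ χ hχ g hg hg0 η δ hη hδ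
  -- smallness of `σ`
  have hsd : SmallDensity uniformProfile σ := (hsmall σ hσ (hσlt.trans_le (min_le_left _ _))).1
  have hσ2 : σ ≤ 1 / 2 := hsd.σ_lt_half.le
  have hσ1 : σ < 1 := hσlt.trans_le ((min_le_right _ _).trans (min_le_left _ _))
  have hs : 0 < σ ^ 3 := pow_pos hσ 3
  have hs20 : σ ^ 3 < η₀' / 20 := by
    have h1 : σ ^ 3 ≤ σ := by
      calc σ ^ 3 ≤ σ ^ 1 := pow_le_pow_of_le_one hσ.le hσ1.le (by norm_num)
        _ = σ := pow_one σ
    exact h1.trans_lt (hσlt.trans_le ((min_le_right _ _).trans (min_le_right _ _)))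
  have hηb0 : 0 ≤ ηb := by linarith
  have hσb : 2 * σ ^ 3 ≤ ηb := by linarith
  have hκ6 : (6 : ℝ) ≤ ηb / σ ^ 3 := by rw [le_div_iff₀ hs]; linarith
  -- regularity of `g`, `Y`, `g·Y`
  obtain ⟨Kg, hKg⟩ := exists_bound_cutoff hg hg0
  have hKg0 : 0 ≤ Kg := (abs_nonneg _).trans (hKg 0 le_rfl)
  have hKY0 : 0 ≤ KY := (abs_nonneg _).trans (hKY 0 le_rfl (by positivity))
  have hψK : ∀ y, 0 ≤ y → |g y * contactValue y| ≤ Kg * KY := by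
    intro y hy
    by_cases hy' : η₀' ≤ y
    · rw [hg0 y hy', zero_mul, abs_zero]; positivity
    · rw [abs_mul]
      exact mul_le_mul (hKg y hy) (hKY y hy (by linarith [not_le.1 hy'])) (abs_nonneg _) hKg0
  have hYcσ : ContinuousAt contactValue (σ ^ 3) := hYc _ hs (by linarith)
  have hψc : ContinuousAt (fun y => g y * contactValue y) (σ ^ 3) := hg.continuousAt.mul hYcσ
  -- `r₀ := 1/4`
  refine ⟨1 / 4, by norm_num, fun r hr hr4 => ?_⟩
  have hr2 : r < 1 / 2 := by linarith
  -- accuracy of the window terms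
  set ε₁ : ℝ := η * δ / (16 * (σ ^ 3 * τ + 1)) with hε₁
  have hε₁0 : 0 < ε₁ := by rw [hε₁]; positivity
  obtain ⟨m₀, hm₀⟩ := exists_forall_lintegral_cellRate_sub_le (χ := χ) (g := g) (r := r) (ηb := ηb) hsd hab hθb ub hχ hg
    hKg hKY hYcσ hηb0 hηb3 hσb hr hr2 τ hε₁0
  refine ⟨m₀, fun m hm hm1 a ha => ?_⟩
  set r' := admissibleCellSize m with hr'
  have hr'0 : 0 < r' := admissibleCellSize_pos hm1
  obtain ⟨N₁, hN₁⟩ := hm₀ m hm hm1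
  obtain ⟨N₂, hN₂⟩ := exists_forall_lintegral_enskogRate_one_sub_le hsd hab hθb ub hχ hg hψK hψc hr hr2 τ hε₁0
  have hδ' : 0 < δ / (4 * (τ / a + 1)) := by positivity
  obtain ⟨N₃, hN₃⟩ := exists_forall_succ_mul_posGibbs_real_le hsd hab hr'0 hκ6 hδ'
  refine ⟨max N₁ (max N₂ N₃), fun N hN => ?_⟩
  have hN1 : N₁ ≤ N := (le_max_left _ _).trans hN
  have hN2 : N₂ ≤ N := ((le_max_left _ _).trans (le_max_right _ _)).trans hN
  have hN3 : N₃ ≤ N := ((le_max_right _ _).trans (le_max_right _ _)).trans hN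
  -- notation at `N`
  set G := localGibbsLaw σ (fun _ => ab) (fun _ => ub) (fun _ => θb) N (Φ N) with hG
  haveI hGp : IsProbabilityMeasure G := isProbabilityMeasure_localGibbsLaw continuous_const continuous_const
    continuous_const (fun _ => hab) (fun _ => hθb) hσ2 N (Φ N)
  haveI hPp : IsProbabilityMeasure (posGibbsMeasure (fun _ : T3 => ab) (hsDiameter σ N) (N + 1)) :=
    isProbabilityMeasure_posGibbsMeasure continuous_const (fun _ => hab) hσ2 N
  set w := windowLen N τ a with hw
  set Kw := windowNum N τ a with hKw
  have hw0 : 0 < w := windowLen_pos N hτ ha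
  have hε : hsDiameter σ N ≠ 0 := (hsDiameter_pos hσ N).ne'
  set Θb : ℝ := ∫ p, ‖p.1 - p.2‖ ∂((gaussMeasure ub θb).prod (gaussMeasure ub θb)) with hΘb
  set Mt : ℝ → ℝ := fun t => (∫ x, χ (t, x)) * (g (σ ^ 3) * contactValue (σ ^ 3)) * (Real.pi * Θb) with hMt
  -- the main term and the dense event
  set MAIN : Config (N + 1) (Fin 3) T3 → ℝ := fun z => ∑ k ∈ Finset.range Kw, σ ^ 3 * w *
    (cellRate σ N χ g r r' ηb ((k : ℝ) * w) (coarseStateAt σ N (Φ N) r' τ a k z) -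
      enskogRate σ N χ g (fun _ => 1) r ((k : ℝ) * w) ((Φ N).flow ((k : ℝ) * w) z)) with hMAIN
  set DenseU : Set (Config (N + 1) (Fin 3) T3) := {z | ∃ k ∈ Finset.range Kw, ∃ i,
    toroidalDiluteCut σ N r' ηb i (coarseStateAt σ N (Φ N) r' τ a k z) ≠ 1} with hDenseU
  set Aκ : Set (Fin (N + 1) → T3) := {xs | ∃ j : Fin (N + 1), ηb / σ ^ 3 * (((N + 1 : ℕ) : ℝ)) * r' ^ 3 <
    ((Finset.univ.filter fun l : Fin (N + 1) => Torus.coarseCell r' (xs l) = Torus.coarseCell r' (xs j)).card : ℝ)} with hAκ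
  have hAκm : MeasurableSet Aκ := measurableSet_denseEvent N r' (ηb / σ ^ 3)
  set D₀ : Set (Config (N + 1) (Fin 3) T3) := {ζ | (fun i => (ζ i).1) ∈ Aκ} with hD₀
  have hD₀m : MeasurableSet D₀ := (measurable_pi_lambda _ fun i => (measurable_pi_apply i).fst) hAκm
  -- (1) the event inclusion
  have hsub : {z | η < |windowSum σ N (Φ N) r' τ a (hazardWeight σ N χ g r r' τ a) (windowCollisions σ N (Φ N) τ a) z -
      windowSum σ N (Φ N) r' τ a (fun i k p => hazardWeight σ N χ g r r' τ a i k p * toroidalDiluteCut σ N r' ηb i p)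
        (windowCollisions σ N (Φ N) τ a) z +
      σ ^ 3 * w / hsDiameter σ N * windowSum σ N (Φ N) r' τ a
        (fun i k p => hazardWeight σ N χ g r r' τ a i k p * toroidalDiluteCut σ N r' ηb i p)
        (fun i k z => staticHazard σ N r' (coarseStateAt σ N (Φ N) r' τ a k z) i) z -
      riemannEnskog σ N (Φ N) τ a χ g r z|} ⊆ DenseU ∪ {z | ENNReal.ofReal η ≤ ‖MAIN z‖ₑ} := by
    intro z hz
    by_cases hzD : z ∈ DenseU
    · exact Or.inl hzD
    · refine Or.inr ?_
      have hall : ∀ k ∈ Finset.range Kw, ∀ i, toroidalDiluteCut σ N r' ηb i (coarseStateAt σ N (Φ N) r' τ a k z) = 1 := by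
        intro k hk i; by_contra hne; exact hzD ⟨k, hk, i, hne⟩
      have hclump := windowSum_eq_windowSum_mul_of_forall (Φ N) r' τ a ηb (hazardWeight σ N χ g r r' τ a)
        (windowCollisions σ N (Φ N) τ a) hall
      have hmain := mainSum_eq (Φ N) χ g r r' τ a ηb hε z
      simp only [Set.mem_setOf_eq] at hz ⊢
      rw [← hclump, sub_self, zero_add, hmain] at hz
      rw [Real.enorm_eq_ofReal_abs]
      exact ENNReal.ofReal_le_ofReal hz.le
  -- (2) the dense event
  have hDsub : DenseU ⊆ ⋃ k ∈ Finset.range Kw, ((Φ N).flow ((k : ℝ) * w)) ⁻¹' D₀ := by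
    rintro z ⟨k, hk, i, hi⟩
    refine mem_iUnion₂.2 ⟨k, hk, ?_⟩
    simp only [Set.mem_preimage, hD₀, hAκ, Set.mem_setOf_eq]
    exact exists_dense_of_toroidalDiluteCutCells_ne_one hσ hr'0 hηb0 hi
  have hDense : G DenseU ≤ ENNReal.ofReal (δ / 4) := by
    have hP := hN₃ N hN3
    calc G DenseU ≤ G (⋃ k ∈ Finset.range Kw, ((Φ N).flow ((k : ℝ) * w)) ⁻¹' D₀) := measure_mono hDsub
      _ ≤ ∑ k ∈ Finset.range Kw, G (((Φ N).flow ((k : ℝ) * w)) ⁻¹' D₀) := measure_biUnion_finset_le _ _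
      _ = ∑ _k ∈ Finset.range Kw, posGibbsMeasure (fun _ : T3 => ab) (hsDiameter σ N) (N + 1) Aκ := by
          refine Finset.sum_congr rfl fun k _ => ?_
          rw [hG, localGibbsLaw_const_preimage_flow σ ab θb ub N (Φ N) _ hD₀m, localGibbsLaw_posEvent σ hab.le hθb ub N (Φ N) hAκm]
      _ = (Kw : ℝ≥0∞) * posGibbsMeasure (fun _ : T3 => ab) (hsDiameter σ N) (N + 1) Aκ := by
          rw [Finset.sum_const, Finset.card_range, nsmul_eq_mul]
      _ = ENNReal.ofReal ((Kw : ℝ) * (posGibbsMeasure (fun _ : T3 => ab) (hsDiameter σ N) (N + 1)).real Aκ) := by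
          rw [ENNReal.ofReal_mul (Nat.cast_nonneg _), ENNReal.ofReal_natCast, measureReal_def,
            ENNReal.ofReal_toReal (measure_ne_top _ _)]
      _ ≤ ENNReal.ofReal (δ / 4) := by
          refine ENNReal.ofReal_le_ofReal ?_
          have hKwle := windowNum_le N hτ ha
          have hreal0 : 0 ≤ (posGibbsMeasure (fun _ : T3 => ab) (hsDiameter σ N) (N + 1)).real Aκ := measureReal_nonneg
          calc (Kw : ℝ) * (posGibbsMeasure (fun _ : T3 => ab) (hsDiameter σ N) (N + 1)).real Aκ
              ≤ (τ / a + 1) * ((((N + 1 : ℕ) : ℝ)) * (posGibbsMeasure (fun _ : T3 => ab) (hsDiameter σ N) (N + 1)).real Aκ) := by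
                rw [← mul_assoc]; exact mul_le_mul_of_nonneg_right hKwle hreal0
            _ ≤ (τ / a + 1) * (δ / (4 * (τ / a + 1))) := mul_le_mul_of_nonneg_left hP (by positivity)
            _ = δ / 4 := by field_simp
  -- (3) the main term by Markov and stationarity
  have hMAINm : Measurable MAIN := by
    refine Finset.measurable_sum _ fun k _ => Measurable.const_mul ?_ _
    exact (measurable_windowFunctional σ N hχ hg r r' ηb ((k : ℝ) * w)).comp ((Φ N).measurable_flow _)
  have hterm : ∀ k ∈ Finset.range Kw, ∫⁻ z, ‖σ ^ 3 * w *
      (cellRate σ N χ g r r' ηb ((k : ℝ) * w) (coarseStateAt σ N (Φ N) r' τ a k z) -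
        enskogRate σ N χ g (fun _ => 1) r ((k : ℝ) * w) ((Φ N).flow ((k : ℝ) * w) z))‖ₑ ∂G ≤
      ENNReal.ofReal (σ ^ 3 * w * (2 * ε₁)) := by
    intro k hk
    have ht : (k : ℝ) * w ∈ Set.Icc (0 : ℝ) τ := windowStart_mem_Icc N hτ ha (Finset.mem_range.1 hk)
    rw [hG, lintegral_windowTerm_eq (Φ N) r r' ηb hσ.le hχ hg τ a hw0.le k,
      ENNReal.ofReal_mul (p := σ ^ 3 * w) (by positivity)]
    refine mul_le_mul_right ?_ _
    have h1 := hN₁ N hN1 (Φ N) _ ht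
    have h2 := hN₂ N hN2 (Φ N) _ ht
    calc ∫⁻ ζ, ‖cellRate σ N χ g r r' ηb ((k : ℝ) * w) (coarseConfig (Torus.coarseCell r') ζ) -
            enskogRate σ N χ g (fun _ => 1) r ((k : ℝ) * w) ζ‖ₑ ∂G
        ≤ ∫⁻ ζ, (‖cellRate σ N χ g r r' ηb ((k : ℝ) * w) (coarseConfig (Torus.coarseCell r') ζ) - Mt ((k : ℝ) * w)‖ₑ +
            ‖enskogRate σ N χ g (fun _ => 1) r ((k : ℝ) * w) ζ - Mt ((k : ℝ) * w)‖ₑ) ∂G := by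
          refine lintegral_mono fun ζ => ?_
          have e : cellRate σ N χ g r r' ηb ((k : ℝ) * w) (coarseConfig (Torus.coarseCell r') ζ) -
              enskogRate σ N χ g (fun _ => 1) r ((k : ℝ) * w) ζ =
            (cellRate σ N χ g r r' ηb ((k : ℝ) * w) (coarseConfig (Torus.coarseCell r') ζ) - Mt ((k : ℝ) * w)) -
              (enskogRate σ N χ g (fun _ => 1) r ((k : ℝ) * w) ζ - Mt ((k : ℝ) * w)) := by ring
          rw [e]
          exact enorm_sub_le
      _ = (∫⁻ ζ, ‖cellRate σ N χ g r r' ηb ((k : ℝ) * w) (coarseConfig (Torus.coarseCell r') ζ) - Mt ((k : ℝ) * w)‖ₑ ∂G) +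
            ∫⁻ ζ, ‖enskogRate σ N χ g (fun _ => 1) r ((k : ℝ) * w) ζ - Mt ((k : ℝ) * w)‖ₑ ∂G :=
          lintegral_add_left ((((measurable_cellRate σ N χ g r r' ηb _).comp
            (measurable_coarseConfig (Torus.measurable_coarseCell r'))).sub measurable_const).enorm) _
      _ ≤ ENNReal.ofReal ε₁ + ENNReal.ofReal ε₁ := add_le_add h1 h2
      _ = ENNReal.ofReal (2 * ε₁) := by rw [← ENNReal.ofReal_add hε₁0.le hε₁0.le]; ring_nf
  have hMain : G {z | ENNReal.ofReal η ≤ ‖MAIN z‖ₑ} ≤ ENNReal.ofReal (δ / 4) := by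
    have hmk := meas_ge_le_lintegral_div hMAINm.enorm.aemeasurable (by simpa using hη) ENNReal.ofReal_ne_top
      (μ := G) (ε := ENNReal.ofReal η)
    refine hmk.trans ?_
    have hsum : ∫⁻ z, ‖MAIN z‖ₑ ∂G ≤ ENNReal.ofReal (2 * σ ^ 3 * τ * ε₁) := by
      calc ∫⁻ z, ‖MAIN z‖ₑ ∂G ≤ ∫⁻ z, ∑ k ∈ Finset.range Kw, ‖σ ^ 3 * w *
            (cellRate σ N χ g r r' ηb ((k : ℝ) * w) (coarseStateAt σ N (Φ N) r' τ a k z) -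
              enskogRate σ N χ g (fun _ => 1) r ((k : ℝ) * w) ((Φ N).flow ((k : ℝ) * w) z))‖ₑ ∂G :=
            lintegral_mono fun z => enorm_sum_le _ _
        _ = ∑ k ∈ Finset.range Kw, ∫⁻ z, ‖σ ^ 3 * w *
            (cellRate σ N χ g r r' ηb ((k : ℝ) * w) (coarseStateAt σ N (Φ N) r' τ a k z) -
              enskogRate σ N χ g (fun _ => 1) r ((k : ℝ) * w) ((Φ N).flow ((k : ℝ) * w) z))‖ₑ ∂G := by
            refine lintegral_finsetSum _ fun k _ => (Measurable.const_mul ?_ _).enorm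
            exact (measurable_windowFunctional σ N hχ hg r r' ηb ((k : ℝ) * w)).comp ((Φ N).measurable_flow _)
        _ ≤ ∑ _k ∈ Finset.range Kw, ENNReal.ofReal (σ ^ 3 * w * (2 * ε₁)) := Finset.sum_le_sum hterm
        _ = ENNReal.ofReal ((Kw : ℝ) * (σ ^ 3 * w * (2 * ε₁))) := by
            rw [Finset.sum_const, Finset.card_range, nsmul_eq_mul, ENNReal.ofReal_mul (Nat.cast_nonneg _), ENNReal.ofReal_natCast]
        _ = ENNReal.ofReal (2 * σ ^ 3 * τ * ε₁) := by
            congr 1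
            have hKww : (Kw : ℝ) * w = τ := windowNum_mul_windowLen N hτ ha
            calc (Kw : ℝ) * (σ ^ 3 * w * (2 * ε₁)) = σ ^ 3 * ((Kw : ℝ) * w) * (2 * ε₁) := by ring
              _ = 2 * σ ^ 3 * τ * ε₁ := by rw [hKww]; ring
    calc (∫⁻ z, ‖MAIN z‖ₑ ∂G) / ENNReal.ofReal η ≤ ENNReal.ofReal (2 * σ ^ 3 * τ * ε₁) / ENNReal.ofReal η :=
          ENNReal.div_le_div_right hsum _
      _ = ENNReal.ofReal (2 * σ ^ 3 * τ * ε₁ / η) := (ENNReal.ofReal_div_of_pos hη).symm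
      _ ≤ ENNReal.ofReal (δ / 4) := by
          refine ENNReal.ofReal_le_ofReal ?_
          rw [div_le_iff₀ hη, hε₁]
          have h1 : 2 * σ ^ 3 * τ * (η * δ / (16 * (σ ^ 3 * τ + 1))) = (σ ^ 3 * τ) / (σ ^ 3 * τ + 1) * (η * δ / 8) := by
            field_simp; ring
          rw [h1]
          have h2 : (σ ^ 3 * τ) / (σ ^ 3 * τ + 1) ≤ 1 := (div_le_one (by positivity)).2 (by linarith)
          nlinarith [mul_le_mul_of_nonneg_right h2 (by positivity : 0 ≤ η * δ / 8)]
  -- (4) conclusion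
  calc G _ ≤ G (DenseU ∪ {z | ENNReal.ofReal η ≤ ‖MAIN z‖ₑ}) := measure_mono hsub
    _ ≤ G DenseU + G {z | ENNReal.ofReal η ≤ ‖MAIN z‖ₑ} := measure_union_le _ _
    _ ≤ ENNReal.ofReal (δ / 4) + ENNReal.ofReal (δ / 4) := add_le_add hDense hMain
    _ = ENNReal.ofReal (δ / 2) := by rw [← ENNReal.ofReal_add (by positivity) (by positivity)]; ring_nf
    _ ≤ ENNReal.ofReal δ := ENNReal.ofReal_le_ofReal (by linarith)

end Summit.AtomisticToContinuum.HydrodynamicLimit.Theorems.CollisionRate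

end
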